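import Literature.MathematicalPhysics.QuantumFieldTheory.Balaban1983to89.B9Eq315QTower
import Literature.MathematicalPhysics.QuantumFieldTheory.Balaban1983to89.B9Eq315QLipschitz

/-!
# `Balaban1983to89.B7Eq43AveragedSmallness` — T. Bałaban, *Averaging operations for lattice gauge theories*, Commun. Math. Phys. **98** (1985)
# 17–51 [Balaban1985Averaging] (42)–(43) pp. 23–24 with the displays before (47) p. 25: THE AVERAGED BACKGROUNDS `Ū^j` OF A CONFIGURATION WITH
# `ε`-SMALL BOND VARIABLES HAVE `(8(d+1)L)^j·ε`-SMALL BOND VARIABLES — the displayed per-level smallness of the NE9 chain's tower letters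
# (`B9Eq315QTowerLipschitz`, this lineage gen 83) READ OFF the bond smallness of `U` itself, from the NE7c ∕ lit-balaban crews' kernel
# `B7Prop1Explicit.side_estimate` (p. 25: `|V̄₀_c − 1| ≤ 2θ`)

statement-level skeleton of published theorems with citation tags; proofs where landed; nothing here is a claim about the Yang–Mills mass gap

CITATION HEADER (lean-in-tree rule).  Audit cell `pub-balaban`, sub-cell `t4`, BINDER row NE9; filed by the row OWNER lineage `b2b-balaban-t4-ne9-p1`
(gen 83).  Source READ by this lineage in the held text: [Balaban1985Averaging] pp. 23–25 (`paper:balaban1985-cmp98-averaging`, journal page = PDF page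
+ 16).

THE PRINT (verbatim).  (42) p. 23: the one-step average `Ū(c) = exp[…] U(Γ_c)`; (43) p. 24: *«Ū^{k+1} = \overline{(Ū^k)}»*; p. 25, before (47):
*«|V̄₀,c − 1 − i Σ_{x∈B(c₋)} L^{−d} A(Γ_{c,x})| < O(1)(L²α₀)²»* (one side of the averaged plaquette, in the gauge `V₀ = exp A` with `A` small).

WHY THIS FILE (cell context).  `B9Eq315QTowerLipschitz` (this generation) produces the TOWER averaging letters `ρ′_k`, `δ_{Q,k}` of the `k`-level
chart files (`B9Thm311SmallFieldCoercivityTower`, `Support/NE9CurChartTower`) modulo the DISPLAYED smallness `‖Ū^j(b) − 1‖ ≤ ε̄` of the level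
backgrounds `UlevOf L m k U j`.  This file reads that display off `‖U(b) − 1‖ ≤ ε`: `ε̄ := (8(d+1)L)^k·ε`, under the numerical condition
`(8(d+1)L)^k·ε ≤ 1∕32` (each averaging stays inside the logarithm's domain).

WHAT IS PROVED (sorry-free; proof lane — no `def`, no `Prop` placeholder, no inequality of the paper asserted hypothesis-free).
* **`norm_bavg_sub_one_le_of_bonds`** — ONE STEP: `‖U(b) − 1‖ ≤ ε` on all bonds of `ℤ^d`, `4(d+1)L·ε ≤ 1∕64` ⇒ `‖Ū(c) − 1‖ ≤ 8(d+1)L·ε` on every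
  `L`-bond (`side_estimate` at `A := log U`, `θ := (2dL + 2L)·2ε`, via `bond_log`).
* **`norm_avgIter_sub_one_le`** — `j` STEPS: `‖Ū^j(b) − 1‖ ≤ (8(d+1)L)^j·ε` when `(8(d+1)L)^j·ε ≤ 1∕32` (induction on (43); the rescaling
  `B7Prop2Explicit.rescale` does not change the range of values).
* **`pdev_le_of_bonds`** — `ε`-small unit-bounded bond variables have plaquette deviation `pdev ≤ 4ε` (each plaquette holonomy is a product of four
  near-identity variables, NE9 leaf-04's `B9Eq315QLipschitz.norm_hol_sub_one_le`): the `h52`∕(52) smallness letter of the tower files READ OFF `ε`.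
* **`norm_UlevOf_sub_one_le`** — THE TOWER READING: for a background `U` of the finest torus `T_{L^k m}` with `‖U(b) − 1‖ ≤ ε` and
  `(8(d+1)L)^k·ε ≤ 1∕32`, every level background satisfies `‖UlevOf L m k U j b − 1‖ ≤ (8(d+1)L)^k·ε` — the `hUε` display of
  `B9Eq315QTowerLipschitz.norm_QprimeTowerW_sub_flat_le` ∕ `norm_QkW_sub_flat_le` with `ε̄ := (8(d+1)L)^k·ε`.
HONEST SCOPE.  [folklore] iteration of a landed one-step estimate; crude constants exponential in the number of levels (print's Prop. 2 (52)–(54)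
keeps the REGULARITY `α₀L^{−2}`-scaled level by level — a different, sharper statement, NOT this); the unit-boundedness `Ū^j(b) ∈ U1` is NOT here
(it needs an averaging-closed subgroup, `B7Prop2Explicit.AvgClosed` ∕ `B11Eq44COperatorTower.ulev_mem_U1_of_pdev`); NOT summit progress (cell
pub-balaban: NE9 NOT PRINTED ∕ NOT PROVED; spine PROVED 0∕9).  NEW file; nothing modified.  Net new unproved facts: 0.
-/

noncomputable section

open scoped BigOperators
open NormedSpace

namespace Literature.MathematicalPhysics.QuantumFieldTheory.Balaban1983to89.B7Eq43AveragedSmallness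

open B7Prop1Explicit (l1 bavg side_estimate bond_log U1 plaqWord)
open B7Prop2Explicit (pdev)
open B9Eq315QLipschitz (norm_hol_sub_one_le)
open B7Prop2Explicit (avgIter avgIter_succ rescale rescale_apply)
open B9SectCLatticeCarrier (Bond)
open B9Eq315QTorus (perSite perCfg perCfg_apply)
open B9Eq315QTower (towerP UlevOf)
open B9Eq315QTorusOnto (liftSite)

variable {d : ℕ} {𝔸 : Type*} [NormedRing 𝔸] [NormedAlgebra ℂ 𝔸] [CompleteSpace 𝔸] (L : ℕ) (hL : 1 ≤ L)

include hL in
/-- **ONE STEP OF (42): `ε`-SMALL BONDS AVERAGE TO `8(d+1)L·ε`-SMALL BONDS** — p. 25's `|V̄₀_c − 1| ≤ 2θ` (`B7Prop1Explicit.side_estimate`) in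
the gauge `V₀ = exp A`, `A := log V₀` (`bond_log`, `|A| ≤ 2ε`), with `θ := (2dL + 2L)·2ε ≤ 1∕64`. [cite: Balaban1985Averaging, (42) p.23, p.25] -/
theorem norm_bavg_sub_one_le_of_bonds {V : B7Prop1Explicit.Site d → Fin d → 𝔸ˣ} {ε : ℝ} (hε : 0 ≤ ε) (hεs : 4 * ((d : ℝ) + 1) * L * ε ≤ 1 / 64)
    (hV : ∀ (x : B7Prop1Explicit.Site d) (κ : Fin d), ‖((V x κ : 𝔸ˣ) : 𝔸) - 1‖ ≤ ε) (q : B7Prop1Explicit.Site d) (κ : Fin d) :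
    ‖((bavg L V q κ : 𝔸ˣ) : 𝔸) - 1‖ ≤ 8 * ((d : ℝ) + 1) * L * ε := by
  have hL1 : (1 : ℝ) ≤ L := by exact_mod_cast hL
  have hd : (0 : ℝ) ≤ d := Nat.cast_nonneg d
  have hdL : (1 : ℝ) ≤ ((d : ℝ) + 1) * L := by nlinarith
  have hε1 : ε ≤ ((d : ℝ) + 1) * L * ε := le_mul_of_one_le_left hε hdL
  have ha1 : 2 * ε ≤ 1 := by nlinarith
  have hb : ∀ (x : B7Prop1Explicit.Site d) (κ : Fin d), l1 (x - q) ≤ 2 * (d * L) + L + L → ‖((V x κ : 𝔸ˣ) : 𝔸) - 1‖ ≤ 2 * ε / 2 :=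
    fun x κ _ => (hV x κ).trans (by linarith)
  have hVA := bond_log q (2 * (d * L) + L + L) ha1 hb
  have hcast : (((2 * (d * L) + L + L : ℕ)) : ℝ) * (2 * ε) = 4 * ((d : ℝ) + 1) * L * ε := by push_cast; ring
  have h := side_estimate V _ q (2 * (d * L) + L + L) (by positivity : (0 : ℝ) ≤ 2 * ε) hVA L hL q κ
    (by simp [l1]) (le_of_eq hcast) (by positivity) hεs
  calc ‖((bavg L V q κ : 𝔸ˣ) : 𝔸) - 1‖ ≤ 2 * (4 * ((d : ℝ) + 1) * L * ε) := h.1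
    _ = 8 * ((d : ℝ) + 1) * L * ε := by ring

include hL in
/-- **`j` STEPS OF (43): `‖Ū^j(b) − 1‖ ≤ (8(d+1)L)^j·ε`** when `‖U(b) − 1‖ ≤ ε` on `ℤ^d` and `(8(d+1)L)^j·ε ≤ 1∕32` (so that every intermediate
average stays in the domain of p. 25's estimate); the rescaling in (43) (`B7Prop2Explicit.rescale`) only relabels bonds.
[cite: Balaban1985Averaging, (42)–(43) pp.23–24, p.25] -/
theorem norm_avgIter_sub_one_le {V : B7Prop1Explicit.Site d → Fin d → 𝔸ˣ} {ε : ℝ} (hε : 0 ≤ ε) (hV : ∀ (x : B7Prop1Explicit.Site d) (κ : Fin d), ‖((V x κ : 𝔸ˣ) : 𝔸) - 1‖ ≤ ε) :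
    ∀ j : ℕ, (8 * ((d : ℝ) + 1) * L) ^ j * ε ≤ 1 / 32 →
      ∀ (x : B7Prop1Explicit.Site d) (κ : Fin d), ‖((avgIter L V j x κ : 𝔸ˣ) : 𝔸) - 1‖ ≤ (8 * ((d : ℝ) + 1) * L) ^ j * ε
  | 0, _, x, κ => by simpa using hV x κ
  | j + 1, hs, x, κ => by
    have hL1 : (1 : ℝ) ≤ L := by exact_mod_cast hL
    have hd : (0 : ℝ) ≤ d := Nat.cast_nonneg d
    have hC1 : (1 : ℝ) ≤ 8 * ((d : ℝ) + 1) * L := by nlinarith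
    have hCj : 0 ≤ (8 * ((d : ℝ) + 1) * L) ^ j * ε := by positivity
    -- the condition at `j` follows from the one at `j+1`
    have hs' : (8 * ((d : ℝ) + 1) * L) ^ j * ε ≤ 1 / 32 := by
      have : (8 * ((d : ℝ) + 1) * L) ^ j * ε ≤ (8 * ((d : ℝ) + 1) * L) ^ (j + 1) * ε := by
        rw [pow_succ]
        exact mul_le_mul_of_nonneg_right (le_mul_of_one_le_right (by positivity) hC1) hε
      exact this.trans hs
    have ih := norm_avgIter_sub_one_le hε hV j hs'
    -- the stage condition `4(d+1)L·ε_j ≤ 1/64` IS `C^{j+1}ε/2 ≤ 1/64`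
    have hstage : 4 * ((d : ℝ) + 1) * L * ((8 * ((d : ℝ) + 1) * L) ^ j * ε) ≤ 1 / 64 := by
      have : 4 * ((d : ℝ) + 1) * L * ((8 * ((d : ℝ) + 1) * L) ^ j * ε) = (8 * ((d : ℝ) + 1) * L) ^ (j + 1) * ε / 2 := by
        rw [pow_succ]; ring
      rw [this]; linarith
    rw [avgIter_succ, rescale_apply]
    calc ‖((bavg L (avgIter L V j) ((L : ℤ) • x) κ : 𝔸ˣ) : 𝔸) - 1‖ ≤ 8 * ((d : ℝ) + 1) * L * ((8 * ((d : ℝ) + 1) * L) ^ j * ε) :=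
          norm_bavg_sub_one_le_of_bonds L hL hCj hstage ih _ κ
      _ = (8 * ((d : ℝ) + 1) * L) ^ (j + 1) * ε := by rw [pow_succ]; ring

include hL in
/-- **THE TOWER READING: the level backgrounds `Ū^{k−1−j}` of a background `U` of the finest torus `T_{L^k m}` with `ε`-small bond variables have
`(8(d+1)L)^k·ε`-small bond variables** (`(8(d+1)L)^k·ε ≤ 1∕32`) — the `hUε` display of `B9Eq315QTowerLipschitz` with `ε̄ := (8(d+1)L)^k·ε`
(`UlevOf … j b = avgIter L Ũ (k−1−j) …`, `k − 1 − j ≤ k`, the periodic extension `Ũ` takes the values of `U`). [cite: Balaban1985Averaging, (42)–(43) pp.23–24; Balaban1985BackgroundPropagators, (3.15) p.393] -/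
theorem norm_UlevOf_sub_one_le (m : Fin d → ℕ) [∀ i, NeZero (m i)] [NeZero L] (k : ℕ) (U : Bond d (towerP L m k) → 𝔸ˣ) {ε : ℝ} (hε : 0 ≤ ε)
    (hU : ∀ b, ‖((U b : 𝔸ˣ) : 𝔸) - 1‖ ≤ ε) (hs : (8 * ((d : ℝ) + 1) * L) ^ k * ε ≤ 1 / 32) (j : ℕ) (b : Bond d (towerP L m (j + 1))) :
    ‖((UlevOf L m k U j b : 𝔸ˣ) : 𝔸) - 1‖ ≤ (8 * ((d : ℝ) + 1) * L) ^ k * ε := by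
  have hL1 : (1 : ℝ) ≤ L := by exact_mod_cast hL
  have hd : (0 : ℝ) ≤ d := Nat.cast_nonneg d
  have hC1 : (1 : ℝ) ≤ 8 * ((d : ℝ) + 1) * L := by nlinarith
  have hV : ∀ (x : B7Prop1Explicit.Site d) (κ : Fin d), ‖((perCfg (towerP L m k) U x κ : 𝔸ˣ) : 𝔸) - 1‖ ≤ ε := fun x κ => by
    rw [perCfg_apply]; exact hU _
  have hmono : (8 * ((d : ℝ) + 1) * L) ^ (k - 1 - j) * ε ≤ (8 * ((d : ℝ) + 1) * L) ^ k * ε :=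
    mul_le_mul_of_nonneg_right (pow_le_pow_right₀ hC1 (by omega)) hε
  exact (norm_avgIter_sub_one_le L hL hε hV (k - 1 - j) (hmono.trans hs) _ _).trans hmono

omit [NormedAlgebra ℂ 𝔸] [CompleteSpace 𝔸] in
/-- **`ε`-SMALL UNIT-BOUNDED BOND VARIABLES HAVE PLAQUETTE DEVIATION `pdev ≤ 4ε`** — every plaquette holonomy `U(∂p)` is a product of four bond
variables (two inverted) each `ε`-close to `1` (NE9 leaf-04's `norm_hol_sub_one_le`); the (52)-type letter `pdev(Ũ) < α₀L^{−2k}` of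
`B11Eq44COperatorTower` ∕ `B11Eq44CLetterTower` thereby follows from `4ε < α₀L^{−2k}`. [cite: Balaban1985Averaging, (9) p.18, Proposition 2 (52) p.26] -/
theorem pdev_le_of_bonds [NormOneClass 𝔸] {V : B7Prop1Explicit.Site d → Fin d → 𝔸ˣ} (hV1 : ∀ (x : B7Prop1Explicit.Site d) (κ : Fin d), V x κ ∈ U1 𝔸)
    {ε : ℝ} (hε : 0 ≤ ε) (hV : ∀ (x : B7Prop1Explicit.Site d) (κ : Fin d), ‖((V x κ : 𝔸ˣ) : 𝔸) - 1‖ ≤ ε) : pdev V ≤ 4 * ε := by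
  refine Real.iSup_le (fun p => ?_) (by positivity)
  have h := norm_hol_sub_one_le hV1 hV p.1 (plaqWord p.2.1 p.2.2)
  have hl : (((plaqWord p.2.1 p.2.2).length : ℕ) : ℝ) = 4 := by simp [plaqWord]
  rw [hl] at h
  exact h

end Literature.MathematicalPhysics.QuantumFieldTheory.Balaban1983to89.B7Eq43AveragedSmallness

end
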